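import Mathlib
import Summits.Ventures.PercRepro2.HCov
import Summits.Ventures.PercRepro2.CutVertexPaths
import Summits.Ventures.PercRepro2.LeafMarkAny
import Summits.Ventures.PercRepro2.IsolatedMark
import Summits.Ventures.PercRepro2.CutReduction
import Summits.Ventures.PercRepro2.GcSkelRules
import Summits.Ventures.PercRepro2.GcSkelReduction
import Summits.Ventures.PercRepro2.GcSkelReductionS
import Summits.Ventures.PercRepro2.GcSkelReductionC
import Summits.Ventures.PercRepro2.HubClassesAll
import Summits.Ventures.PercRepro2.GcSkelReductionR
import Summits.Ventures.PercRepro2.GcSkelReductionN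
import Summits.Ventures.PercRepro2.GcSkelReductionB
import Summits.Ventures.PercRepro2.GcSkelReductionSeven
import Summits.Ventures.PercRepro2.GcSkelReductionP

/-!
# The residual with no isolated mark, inside p5's cut-vertex class (blind cell PercRepro2, typer-1 g53)

p5 g24's `IsolatedMark.HCov_isolated_mark` (IsolatedMark.lean): (HCOV) outright when one of
`a₁, a₂, o, b` is isolated (every edge at it a loop). One more clause of the weighted residual:
**`WReducedI`** := `WReducedP` ∧ none of `a₁, a₂, o, b` isolated; **`HCov_all_iff_HCovWRedI_all`**.

With it the residual sits INSIDE the two classes of p5 g24's reductions, as a theorem on the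
predicates: **`noMarkBehindCut_of_wredI`** — an instance of `WReducedI` is in
`CutReduction.NoMarkBehindCut` (no cut vertex separates one of `a₁, a₂, o, b` alone from the other
marks: such a mark `w` has at most one non-loop edge on its side (`oneFar`), is not isolated and not
a leaf, so has two non-loop edges, both on its side) — and **`degGeTwo_of_wredI`** — it is in
`IsolatedMark.DegGeTwo` (no mark among `a₁, a₂, o, b` isolated or a genuine leaf). Hence
**`HCovWRedI_all_of_HCovNC_all`** / **`HCovWRedI_all_of_HCovDeg2_all`**: (HCOV) on either of p5's
classes gives (HCOV) on the residual, and with `HCov_all_of_HCovWRedI_all` the three closures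
`HCovNC_all`, `HCovDeg2_all`, `HCovWRedI_all` are equivalent to `HCov_all`.
-/

namespace Summit.Ventures.PercRepro2

open CovForm CutVertexM9

namespace WRed

section ClassI

variable {V : Type*} {E : Type*} [Fintype E] [DecidableEq E] [DecidableEq V]

/-- **The residual with no isolated mark**: `WReducedP`, and none of `a₁, a₂, o, b` is isolated. -/
structure WReducedI (ends : E → Sym2 V) (o a₁ a₂ a₃ b : V) : Prop
    extends WReducedP ends o a₁ a₂ a₃ b where
  /-- `a₁` is not isolated -/
  notIso_a1 : ¬ IsolatedMark.IsIsolated ends a₁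
  /-- `a₂` is not isolated -/
  notIso_a2 : ¬ IsolatedMark.IsIsolated ends a₂
  /-- `o` is not isolated -/
  notIso_o : ¬ IsolatedMark.IsIsolated ends o
  /-- `b` is not isolated -/
  notIso_b : ¬ IsolatedMark.IsIsolated ends b

end ClassI

section Closure

variable (R : Type*) [Field R] [LinearOrder R] [IsStrictOrderedRing R]

/-- **(HCOV) on the residual with no isolated mark**. -/
def HCovWRedI_all : Prop :=
  ∀ (V E : Type) [Fintype V] [DecidableEq V] [Fintype E] [DecidableEq E]
    (ends : E → Sym2 V) (p : E → R), IsProbVec p →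
    ∀ o a₁ a₂ a₃ b : V, a₁ ≠ a₂ → a₁ ≠ a₃ → a₂ ≠ a₃ → o ≠ a₁ → o ≠ a₂ → o ≠ a₃ → o ≠ b →
      b ≠ a₁ → b ≠ a₂ → b ≠ a₃ → WReducedI ends o a₁ a₂ a₃ b → HCov p ends o a₁ a₂ a₃ b

end Closure

section Main

variable {R : Type*} [Field R] [LinearOrder R] [IsStrictOrderedRing R]

omit [IsStrictOrderedRing R] in
/-- (HCOV) on `WReducedP` follows from (HCOV) on `WReducedI`: an isolated mark among `a₁, a₂, o, b`
is (HCOV) outright (p5 g24). -/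
theorem HCovWRedP_all_of_HCovWRedI_all (hB : HCovWRedI_all R) : HCovWRedP_all R := by
  intro V E _ _ _ _ ends p hp o a₁ a₂ a₃ b h12 h13 h23 ho1 ho2 ho3 hob hb1 hb2 hb3 hred
  by_cases hiso : IsolatedMark.IsIsolated ends a₁ ∨ IsolatedMark.IsIsolated ends a₂ ∨
      IsolatedMark.IsIsolated ends o ∨ IsolatedMark.IsIsolated ends b
  · exact IsolatedMark.HCov_isolated_mark p h12 h13 h23 ho1 ho2 hb1 hb2 hiso
  push Not at hiso
  exact hB V E ends p hp o a₁ a₂ a₃ b h12 h13 h23 ho1 ho2 ho3 hob hb1 hb2 hb3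
    ⟨hred, hiso.1, hiso.2.1, hiso.2.2.1, hiso.2.2.2⟩

/-- **THE WEIGHTED RESIDUAL WITH NO ISOLATED MARK**: (HCOV) for every finite weighted graph with
five distinct marks follows from (HCOV) on `WReducedI`. -/
theorem HCov_all_of_HCovWRedI_all (hB : HCovWRedI_all R) : HCov_all R :=
  HCov_all_of_HCovWRedP_all (HCovWRedP_all_of_HCovWRedI_all hB)

/-- The residual with no isolated mark is a faithful reduction. -/
theorem HCov_all_iff_HCovWRedI_all : HCov_all R ↔ HCovWRedI_all R :=
  ⟨fun h V E _ _ _ _ ends p hp o a₁ a₂ a₃ b h12 h13 h23 ho1 ho2 ho3 hob hb1 hb2 hb3 _ =>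
    h V E ends p hp o a₁ a₂ a₃ b h12 h13 h23 ho1 ho2 ho3 hob hb1 hb2 hb3,
   HCov_all_of_HCovWRedI_all⟩

end Main

/-! ## The residual inside p5's classes -/

section Nesting

variable {V : Type*} {E : Type*} [Fintype E] [DecidableEq E] [DecidableEq V]

omit [DecidableEq E] in
/-- A mark of non-loop degree `≠ 1` is not a genuine leaf at any vertex through any edge. -/
lemma not_isLeafAt_of_nonLoopDeg_ne_one {ends : E → Sym2 V} {m : V} (hm : nonLoopDeg ends m ≠ 1)
    (e : E) (y : V) : ¬ LeafMarkAny.IsLeafAt ends m y e := by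
  rintro ⟨he, hmy, honly⟩
  apply hm
  have hset : edgesAt ends m = {e} := by
    ext g
    rw [mem_edgesAt, Finset.mem_singleton]
    constructor
    · rintro ⟨hg, -⟩
      exact honly g hg
    · rintro rfl
      refine ⟨by rw [he]; exact Sym2.mem_mk_left _ _, ?_⟩
      rw [he, Sym2.mk_isDiag_iff]
      exact hmy
  unfold nonLoopDeg
  rw [hset, Finset.card_singleton]

omit [DecidableEq E] in
/-- **No mark among `a₁, a₂, o, b` is a leaf on the residual**: the degree clauses of `WReduced` /
`WReducedP` give p5 g24's `NoLeafMark`. -/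
theorem noLeafMark_of_wredI {ends : E → Sym2 V} {o a₁ a₂ a₃ b : V}
    (h : WReducedI ends o a₁ a₂ a₃ b) : LeafMarkAny.NoLeafMark ends o a₁ a₂ b := fun e y =>
  ⟨not_isLeafAt_of_nonLoopDeg_ne_one h.deg_a1 e y, not_isLeafAt_of_nonLoopDeg_ne_one h.deg_a2 e y,
    not_isLeafAt_of_nonLoopDeg_ne_one h.deg_o e y, not_isLeafAt_of_nonLoopDeg_ne_one h.deg_b e y⟩

omit [DecidableEq E] in
/-- **The residual is inside `DegGeTwo`**: none of `a₁, a₂, o, b` isolated or a leaf. -/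
theorem degGeTwo_of_wredI {ends : E → Sym2 V} {o a₁ a₂ a₃ b : V}
    (h : WReducedI ends o a₁ a₂ a₃ b) : IsolatedMark.DegGeTwo ends o a₁ a₂ b :=
  ⟨⟨h.notIso_a1, h.notIso_a2, h.notIso_o, h.notIso_b⟩, noLeafMark_of_wredI h⟩

omit [DecidableEq E] in
/-- A vertex of non-loop degree `≠ 1` that is not isolated has two distinct non-loop edges. -/
lemma two_edges_of_not_isolated {ends : E → Sym2 V} {w : V} (hdeg : nonLoopDeg ends w ≠ 1)
    (hiso : ¬ IsolatedMark.IsIsolated ends w) :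
    ∃ g₁ g₂ : E, g₁ ≠ g₂ ∧ (w ∈ ends g₁ ∧ ¬ (ends g₁).IsDiag) ∧ (w ∈ ends g₂ ∧ ¬ (ends g₂).IsDiag) := by
  have hpos : 0 < nonLoopDeg ends w := by
    unfold IsolatedMark.IsIsolated at hiso
    push Not at hiso
    obtain ⟨e, hwe, hd⟩ := hiso
    exact Finset.card_pos.mpr ⟨e, mem_edgesAt.mpr ⟨hwe, hd⟩⟩
  have hlt : 1 < nonLoopDeg ends w := by omega
  obtain ⟨g₁, hg₁, g₂, hg₂, hne⟩ := Finset.one_lt_card.1 hlt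
  rw [mem_edgesAt] at hg₁ hg₂
  exact ⟨g₁, g₂, hne, hg₁, hg₂⟩

omit [Fintype E] [DecidableEq E] [DecidableEq V] in
/-- At a cut vertex, a non-loop edge at a left vertex is a left edge. -/
lemma side_eq_true_of_mem_left {ends : E → Sym2 V} {side : E → Bool} {L : Set V} {v : V}
    {Rt : Set V} (hcut : CutVertex ends side L v Rt) {w : V} (hw : w ∈ L) {g : E}
    (hg : w ∈ ends g) : side g = true := by
  cases hs : side g with
  | true => rfl
  | false =>
    exfalso
    rcases hcut.right g hs w hg with hR | hv
    · exact hcut.disj w hw hR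
    · exact hcut.vL (hv ▸ hw)

omit [DecidableEq E] in
/-- **The residual is inside `NoMarkBehindCut`**: on `WReducedI` no cut vertex separates one of
`a₁, a₂, o, b` alone from the other marks — such a mark has at most one non-loop edge on its side
(`oneFar`), but being neither isolated nor a leaf it has two, both on its side. -/
theorem noMarkBehindCut_of_wredI {ends : E → Sym2 V} {o a₁ a₂ a₃ b : V}
    (h : WReducedI ends o a₁ a₂ a₃ b) : CutReduction.NoMarkBehindCut ends o a₁ a₂ a₃ b := by
  rintro ⟨side, L, Rt, v, w, hcut, hw, hwm, hM⟩
  have hone : leftCard ends side ≤ 1 := h.oneFar side L v Rt w hcut hw hM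
  have hdeg : nonLoopDeg ends w ≠ 1 := by
    rcases hwm with rfl | rfl | rfl | rfl
    · exact h.deg_a1
    · exact h.deg_a2
    · exact h.deg_o
    · exact h.deg_b
  have hiso : ¬ IsolatedMark.IsIsolated ends w := by
    rcases hwm with rfl | rfl | rfl | rfl
    · exact h.notIso_a1
    · exact h.notIso_a2
    · exact h.notIso_o
    · exact h.notIso_b
  obtain ⟨g₁, g₂, hne, hg₁, hg₂⟩ := two_edges_of_not_isolated hdeg hiso
  have hlt : 1 < leftCard ends side := by
    unfold leftCard
    exact Finset.one_lt_card.2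
      ⟨g₁, Finset.mem_filter.2 ⟨Finset.mem_univ _, side_eq_true_of_mem_left hcut hw hg₁.1, hg₁.2⟩,
        g₂, Finset.mem_filter.2 ⟨Finset.mem_univ _, side_eq_true_of_mem_left hcut hw hg₂.1, hg₂.2⟩,
        hne⟩
  omega

end Nesting

section NestingClosure

variable {R : Type*} [Field R] [LinearOrder R] [IsStrictOrderedRing R]

omit [IsStrictOrderedRing R] in
/-- (HCOV) on p5 g24's `NoMarkBehindCut` gives (HCOV) on the residual `WReducedI`. -/
theorem HCovWRedI_all_of_HCovNC_all (hB : CutReduction.HCovNC_all R) : HCovWRedI_all R := by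
  intro V E _ _ _ _ ends p hp o a₁ a₂ a₃ b h12 h13 h23 ho1 ho2 ho3 hob hb1 hb2 hb3 hred
  exact hB V E ends p hp o a₁ a₂ a₃ b h12 h13 h23 ho1 ho2 ho3 hob hb1 hb2 hb3
    (noMarkBehindCut_of_wredI hred)

omit [IsStrictOrderedRing R] in
/-- (HCOV) on p5 g24's `DegGeTwo` gives (HCOV) on the residual `WReducedI`. -/
theorem HCovWRedI_all_of_HCovDeg2_all (hB : IsolatedMark.HCovDeg2_all R) : HCovWRedI_all R := by
  intro V E _ _ _ _ ends p hp o a₁ a₂ a₃ b h12 h13 h23 ho1 ho2 ho3 hob hb1 hb2 hb3 hred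
  exact hB V E ends p hp o a₁ a₂ a₃ b h12 h13 h23 ho1 ho2 ho3 hob hb1 hb2 hb3
    (degGeTwo_of_wredI hred)

/-- **The three closures agree**: (HCOV) on `NoMarkBehindCut`, on `DegGeTwo` and on the residual
`WReducedI` are each equivalent to `HCov_all`. -/
theorem HCovNC_all_iff_HCovWRedI_all : CutReduction.HCovNC_all R ↔ HCovWRedI_all R :=
  ⟨HCovWRedI_all_of_HCovNC_all,
   fun h V E _ _ _ _ ends p hp o a₁ a₂ a₃ b h12 h13 h23 ho1 ho2 ho3 hob hb1 hb2 hb3 _ =>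
    HCov_all_of_HCovWRedI_all h V E ends p hp o a₁ a₂ a₃ b h12 h13 h23 ho1 ho2 ho3 hob hb1 hb2
      hb3⟩

/-- (HCOV) on `DegGeTwo` is equivalent to (HCOV) on the residual `WReducedI`. -/
theorem HCovDeg2_all_iff_HCovWRedI_all : IsolatedMark.HCovDeg2_all R ↔ HCovWRedI_all R :=
  ⟨HCovWRedI_all_of_HCovDeg2_all,
   fun h V E _ _ _ _ ends p hp o a₁ a₂ a₃ b h12 h13 h23 ho1 ho2 ho3 hob hb1 hb2 hb3 _ =>
    HCov_all_of_HCovWRedI_all h V E ends p hp o a₁ a₂ a₃ b h12 h13 h23 ho1 ho2 ho3 hob hb1 hb2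
      hb3⟩

end NestingClosure

end WRed

end Summit.Ventures.PercRepro2
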